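import Literature.NumberTheory.EllipticCurves.BurungaleKobayashiNakamuraOta2026.AnticyclotomicRankGrowth
import Literature.NumberTheory.EllipticCurves.RohrlichAnticyclotomicRootNumber
import Literature.NumberTheory.EllipticCurves.RootNumberSignProofs
import Literature.NumberTheory.EllipticCurves.HeegnerPoints
import Literature.NumberTheory.EllipticCurves.Tamagawa
import Literature.NumberTheory.GaloisRepresentations.HeckeCharacterConductorExponent
import Mathlib.Data.Nat.Totient
import HarnessLib

/-!
# Li–Xu 2026 (J. Number Theory, doi:10.1016/j.jnt.2026.06.001 = arXiv:2502.12648; REFEREED),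
# Theorem 1, Theorem 3.11 (i) and Proposition 5.2: the GROWTH OF THE MORDELL–WEIL RANK of a CM
# elliptic curve over `ℚ` along the anticyclotomic `ℤ_p`-tower for ALL decomposition types of `p`
# (split: `0` or `2φ(p^n)` per layer according to the root number; inert: `2φ(p^n)` at every other
# layer; RAMIFIED: `φ(p^n)` at every layer), the root numbers of the anticyclotomic twists at split
# and inert `p`, and the finiteness of the torsion over `K^{ac}_∞` — typed STATEMENTS (refereed
# named facts) + kernel bridges to the Burungale–Kobayashi–Nakamura–Ota preprint binders

Topic `NumberTheory/EllipticCurves`, sub-directory `LiXu2026` (namespace = path). Cross-ladder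
literature-typing layer (cell `bsd-littype`, seat 10, generation 4). WHY THIS FILE: the sibling
`BurungaleKobayashiNakamuraOta2026/AnticyclotomicRankGrowth.lean` types BKNO's (1.2) / Thm. 6.7 —
"for `n ≫ 0`, `rank_{𝒪_K} E(K^{ac}_n) = (p^n − 1)/2 + c`" at a RAMIFIED `p` — as a PREPRINT claim binder
(`thm67_mordellWeilRank_layer_OPEN`, arXiv:2608.06879v1, under review). The same growth law is a
PUBLISHED, refereed theorem: Li–Xu, Theorem 1, ramified case ("`ε_n = d`", `d = dim A_φ = 1` for an
elliptic curve), proved from their root-number computation (Thm. 3.11), Rohrlich's theorem on the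
central orders of anticyclotomic twists (tree fact `RohrlichJia_centralOrder_anticyclotomicTwists`) and
Gross–Zagier–Kolyvagin–Zhang. This file vendors Theorem 1 for `E/ℚ` in all three cases AS PRINTED (the
STEP form `rank E(K^{ac}_n) − rank E(K^{ac}_{n−1}) = ε_n φ(p^n)`), and PROVES in the kernel that the
ramified clause yields the closed form `rank_ℤ E(K^{ac}_n) = p^n + C` (`n ≥ n₀`) and that BKNO's binder
implies the step form — so the refereed node and the preprint node are comparable by name (they
differ exactly by the parity of the constant: BKNO's `p^n − 1 + 2c` says `C` is odd, i.e. that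
`rank_ℤ E(K^{ac}_n)` is even — the `𝒪_K`-module structure on `E(K^{ac}_n)`, which the tree's `ℤ`-rank
currency does not carry). The inert clauses are the Mordell–Weil companions of Agboola–Howard's
Selmer-corank Theorem A (`AgboolaHoward2005/SupersingularAnticyclotomicSelmerCorank.lean`).

## The printed statements (arXiv:2502.12648; held text `paper:arxiv-2502.12648`, LaTeX source in
## 3000-character chunks `p0001`–`p0019`; the numbering below is that of the arXiv version)

* §1 (chunk p0002–p0003): "Let `K/ℚ` be an imaginary quadratic extension, and let
  `φ : 𝔸_K^× → ℂ^×` be a unitary anticyclotomic Hecke character of infinite type `(1,0)`. […] one can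
  canonically attach an abelian variety `A_φ` over `ℚ` […] Let `p` be an odd prime number, and let
  `K_∞^{ac}/K` denote the anticyclotomic `ℤ_p`-extension of `K`, with its `n`-th layer denoted by
  `K_n^{ac}` such that `Gal(K_n^{ac}/K) = ℤ/p^nℤ`. We set `K_0^{ac} = K`. […] we can write
  `rank_ℤ A_φ(K_n^{ac}) − rank_ℤ A_φ(K_{n−1}^{ac}) = ε_n φ(p^n)`, where `ε_n` are nonnegative integers."
* **Theorem 1** (chunk p0003): "Let `A_φ` be the abelian variety as described above, and let
  `d = dim A_φ`. Let `p > 2` be a prime number. Denote `W̃(φ) := (1 − W(φ))/2`. Then for `n ≫ 0`: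
  • If `p` splits in `K`, then `ε_n = 0` if `W(φ) = 1`, and `ε_n = 2d` if `W(φ) = −1`.
  • If `p` remains inert in `K`, let `j` be the nonnegative integer so that `H_K ∩ K_∞^{ac} = K_j^{ac}`,
    where `H_K` is the Hilbert class field of `K`, and let `f(φ_p)` be the exponent of the conductor of
    the `p`-component of `φ`. Then — if `j + f(φ_p)` is even, then `ε_n = 2d` if `n ≡ W̃(φ) mod 2`, `0`
    if `n ≢ W̃(φ) mod 2`; — if `j + f(φ_p)` is odd, then `ε_n = 0` if `n ≡ W̃(φ) mod 2`, `2d` if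
    `n ≢ W̃(φ) mod 2`.
  • If `p` is ramified in `K`, then `ε_n = d`."
* §1.1 (chunk p0003): "Let `E` be an elliptic curve over `ℚ` with complex multiplication by `K`. By the
  work of Deuring, there exists a Hecke character `φ` over `K` attached to `E` such that
  `L(E,s) = L(φ,s)`. The character `φ` is anticyclotomic of infinite type `(1,0)`, and `A_φ = E`. By the
  theory of complex multiplication, `K` must have class number one"; Remark 4.3 (chunk p0016): "in
  the case of elliptic curves `E`, the Hecke field `M` is `ℚ`, implying `[M:ℚ] = 1`. […] `K` must have
  class number one, so `j = 0`. Furthermore, when `E` has good reduction at `p`, the associated Hecke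
  character `φ` of `E` is unramified at `p`. Therefore `j + f(φ_p) = 0`, an even number."
* **Theorem 3.11** (chunk p0014): "For `χ = φρ ∈ 𝔛^{ac}_{φ,n}`, the root number `W(χ)` is given by the
  following formulas. • If `p` splits in `K`, then `W(χ) = W(φ)`, • If `p` remains inert in `K`, then
  `W(χ) = W(φ)` if `n ≤ j + f(φ_p) − 1`, `W(χ) = (−1)^{n − j + 1 − f(φ_p)} W(φ)` if
  `n > j + f(φ_p) − 1`. • [three ramified clauses (iii)–(v), in terms of the local data
  `l₁, l₂, f(φ_v), φ_v(ϖ)`]" — with Remark 3.12: "This result was first observed by Greenberg in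
  [Greenberg 1983] when `p` is unramified in `K`, in the case of elliptic curves `E`." (§2.1.2,
  chunk p0006: `𝔜_n` = the Galois characters of `Gal(K^{ac}_∞/K)` factoring through `Gal(K^{ac}_n/K)`,
  `𝔜_n^† := 𝔜_n ∖ 𝔜_{n−1}` "characters of level `n`", `𝔛^{ac}_{φ,n} := {φρ : ρ ∈ 𝔜_n}`; Prop. 2.4 (2):
  for `ρ` of level `n > j` at an inert `p`, `f(ρ_v) = n − j + 1`.)
* **Proposition 5.2** (chunk p0017): "Let `A/ℚ` be an abelian variety over `ℚ`, then
  `A(K_∞^{ac})_{tors}` is finite." **Corollary 5.4**: "`A_φ(K_∞^{ac})` is a finitely generated abelian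
  group if and only if `p` splits in `K` and `W(φ) = 1`."

## Transcription on the tree's objects (the dictionary; identical to the BKNO / Agboola–Howard
## siblings)

* "`E/ℚ` with complex multiplication by `K`", `φ` Deuring's character, `A_φ = E`, `d = 1`, `j = 0`:
  `W : WeierstrassCurve ℚ`, elliptic, with CM by the MAXIMAL order — `W.j ∈ maximalCMJInvariants`,
  `IsCMFieldOfJ K W.j` (`d_K = cmFieldDiscr W.j`), complex conjugation `c ≠ 1`; `φ` a Hecke character of
  `K` of infinity type `(1,0)`, conj-equivariant, with `L(E/ℚ,s) = L(s,φ)` on `re s > 3/2` (the clauses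
  of `Deuring_exists_heckeCharacter_of_maximalCM`). (Print allows CM by any order of `K`; the four
  non-maximal `j`'s are `ℚ`-isogenous to maximal-order curves and ranks are isogeny invariants — typed
  here at maximal orders only: a SPECIAL CASE, never stronger — `TODO(general form)`.)
* "`W(φ)`": the weight-two root number, `IsCentralRootNumber φ w` with `w : ℤ` cast to `ℂ` (the sign of
  the functional equation of `L(E/ℚ, s) = L(s, φ)`; `w = ±1` by `IsCentralRootNumber.eq_one_or_eq_neg_one`).
* "`p` splits / remains inert / is ramified in `K`" (`K` quadratic, `p` odd): RAMIFIED = `p ∣ d_K`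
  (`(p : ℤ) ∣ cmFieldDiscr W.j`, the BKNO sibling's convention); INERT = `p𝒪_K` is a prime ideal
  (`(Ideal.span {(p : 𝓞 K)}).IsPrime`, the Agboola–Howard sibling's convention); SPLIT = neither
  (`p ∤ d_K` and `p𝒪_K` not prime).
* "`K_n^{ac}`": the layer `κ.layer n` of ANY `κ : ZpExtension K p` with `κ.IsAnticyclotomic`;
  "`rank_ℤ A_φ(K_n^{ac})`" = `(W.baseChange (κ.layer n)).mordellWeilRank` (cast to `ℤ`); "for `n ≫ 0`" =
  `∀ᶠ n in Filter.atTop`. The printed step `rank(K_n) − rank(K_{n−1}) = ε_n φ(p^n)` is typed with the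
  index shifted by one (`rank(K_{n+1}) = rank(K_n) + ε_{n+1} φ(p^{n+1})`, eventually in `n`) — the same
  statement.
* Theorem 1 for `E`, case by case: SPLIT: `ε = 1 − W(φ) ∈ {0, 2}`; INERT under GOOD reduction at `p`
  (`W.HasGoodReductionAtPrime p`, so `j + f(φ_p) = 0` by Remark 4.3): `ε_m = 2` iff `m ≡ W̃(φ) (mod 2)`
  iff `(−1)^m = W(φ)`, i.e. `ε_m = 1 + (−1)^m W(φ)`; RAMIFIED: `ε = 1`. (Inert `p` of BAD reduction —
  `f(φ_p) > 0` — is NOT typed: the conductor exponent of an idelic Hecke character at `p` is not a tree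
  notion; `TODO(general form)`.)
* Thm. 3.11 (ii) for `E` with good reduction (`j = f = 0`): for `ρ` of EXACT level `n ≥ 1`,
  `W(φρ) = (−1)^{n+1} W(φ)` — NOT restated in this file (it is `AgboolaHoward2005.eqn31_rootNumber_layer_inert`
  for `p > 3`, typed from Agboola–Howard's (3.1) on the same binders). PRINT NIT (recorded, not
  silently repaired): Thm. 3.11 is displayed for `χ ∈ 𝔛^{ac}_{φ,n}` (level `≤ n`), but its inert and
  ramified formulas depend on `n` through Prop. 2.4 (2), which is stated for `ρ` "of level `n`"
  (exact level, `𝔜_n^†`); read literally at `ρ = 1 ∈ 𝔜_n` (or at `n = 0`) the inert display would give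
  `W(φ) = −W(φ)`. The coherent reading — exact level `n ≥ 1` — is the one typed (it is also
  Agboola–Howard's (3.1) "primitive character of `Gal(D_n/K)` for `n > 0`", whose Remark 3.2 makes the
  same observation about `n = 0`). Thm. 3.11 (i) (split) is typed for every `ρ ∈ 𝔜` (all levels), as
  displayed.
* Prop. 5.2 for `A = E`: `E(K^{ac}_∞) = ⋃_n E(K^{ac}_n)`, so "`E(K^{ac}_∞)_{tors}` is finite" is
  equivalent to "the torsion orders `#E(K^{ac}_n)_{tors}` (`WeierstrassCurve.torsionOrder`, each finite
  over the number field `K^{ac}_n`) are BOUNDED in `n`" — the typed form (the tree has no group of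
  points over an infinite algebraic extension). Hypotheses as printed: ANY elliptic `W/ℚ` (no CM
  needed), `K` imaginary quadratic (`IsImaginaryQuadratic K`), `p` odd, `κ` anticyclotomic.

## What is here

* `thm1_mordellWeilRank_layer_split`, `thm1_mordellWeilRank_layer_inert`,
  `thm1_mordellWeilRank_layer_ramified` — Theorem 1 for `E/ℚ` (refereed named facts).
* `thm311_rootNumber_split` — Theorem 3.11 (i) for `E/ℚ` (refereed named fact). Theorem 3.11 (ii)
  (inert, good reduction: `W(φρ) = (−1)^{n+1} W(φ)` for `ρ` of exact level `n ≥ 1`) is NOT restated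
  here: for `p > 3` it is Agboola–Howard's (3.1) = Greenberg 1983 p. 247, typed from that source as
  `AgboolaHoward2005.eqn31_rootNumber_layer_inert` (typer lint rule: cite, do not near-duplicate; the
  only extra scope of (ii) is `p = 3`).
* `prop52_torsionOrder_layer_bounded` — Proposition 5.2 for `A = E` (refereed named fact).
* (§5 of this file, added with the conductor-exponent vocabulary
  `HeckeCharacter.HasConductorExponentAt` of `GaloisRepresentations/HeckeCharacterConductorExponent.lean`)
  `thm1_mordellWeilRank_layer_inert_of_conductorExponent` — Theorem 1, inert case, BOTH parity branches
  (`j = 0`, `f(φ_p) = f` arbitrary: jumps `2φ(p^n)` at the layers `n` with `(−1)^{n+f} W(φ) = 1`; covers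
  an inert `p` of BAD reduction, `f > 0`), and `thm311_rootNumber_layer_inert_of_conductorExponent` —
  Thm. 3.11 (ii) in full for `E` (`W(φρ) = W(φ)` for `n ≤ f − 1`, `= (−1)^{n+1−f} W(φ)` for `n ≥ f`, `ρ` of
  exact level `n ≥ 1`); both REFEREED named facts.
* PROVED (kernel; facts as hypotheses; 0 further facts): `mordellWeilRank_layer_eq_pow_add_of_ramified`
  (telescoping the ramified step: `∃ n₀ C, ∀ n ≥ n₀, rank_ℤ E(K^{ac}_n) = p^n + C` — the closed form of
  BKNO's (1.2), up to the parity of `C`); `step_of_thm67_OPEN` (BKNO's preprint binder IMPLIES Li–Xu's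
  ramified step form: `(p^{n+1} − 1 + 2c) − (p^n − 1 + 2c) = φ(p^{n+1})`);
  `tendsto_mordellWeilRank_layer_of_ramified` / `_of_inert` / `_of_split_neg` (unbounded rank: "the
  anticyclotomic `ℤ_p`-extension `K_∞^{ac}/K` again provides a counterexample", §1.3);
  `mordellWeilRank_layer_eventually_const_of_split_pos` (`W(φ) = +1` at a split `p`: the rank is
  eventually constant — the "if" half of Cor. 5.4 in rank currency).

## What is NOT here (typed GAP, reasons)

Theorem 1 / Thm. 3.11 for a general `A_φ` (CM abelian varieties attached to type-`(1,0)` Hecke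
characters of an arbitrary imaginary quadratic `K`, `d = [M:ℚ]`, the invariant `j`): the tree has no
`A_φ` (only elliptic curves) — not typable; Thm. 3.11 (iii)–(v) (ramified root numbers in the local
coordinates `l₁, l₂, f(φ_v), φ_v(ϖ)`): local root numbers of idelic Hecke characters and the
parameters `l₁, l₂` are absent (the inert clauses at BAD reduction ARE typed in §5, through the
conductor exponent `f(φ_p)`); Prop. 4.1 (the isogeny
decomposition `A_n ∼ ∏ A_{φρ}`), Thm. 4.2 (GZK–Zhang for `A_{φρ}`): CM abelian varieties again; Thm. 6.1
(the densities `𝐏^±_N` of even/odd central orders: limits `(1 ± W(φ))/2` (split), `liminf = 1/(p+1)`,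
`limsup = p/(p+1)` (inert), `→ 1/2` (ramified)): typable in principle on `{ρ : ∃ r, IsAcCharacter ι κ N ρ r}`
with the central-order parity read through `CentralValueNeZero` / `HasSimpleCentralZero`, left out to
keep this file to one printed section (§1/§3.3.1/§5); Cor. 5.4 as printed (finite generation of
`E(K^{ac}_∞)`): no group of points over `K^{ac}_∞` in the tree — its rank half is the proved
`mordellWeilRank_layer_eventually_const_of_split_pos` together with the three `tendsto` corollaries.

References: [LiXu2026] H. Li, R. Xu, *On the Mordell–Weil rank of certain CM abelian varieties over
anticyclotomic towers*, J. Number Theory (2026), doi:10.1016/j.jnt.2026.06.001 = arXiv:2502.12648: §1 and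
Thm. 1 (chunks p0002–p0003), §1.1 and §1.3 (p0003–p0004), §2.1.2 (p0006), Prop. 2.4 (p0007–p0008),
Thm. 3.11 and Rem. 3.12 (p0014), §4 proof of Thm. 1 and Rem. 4.3 (p0015–p0016), Prop. 5.2 and
Cor. 5.4 (p0017) [corpus: paper:arxiv-2502.12648 p0002–p0004, p0006–p0008, p0014–p0017] (typed from
the arXiv text; the published numbering is to be checked against the journal version);
[Greenberg1983] Invent. Math. 72, p. 247 (Rem. 3.12's attribution); [AgboolaHoward2005] (3.1) and
Thm. A; [Rohrlich1984Anticyclotomic] (tree `RohrlichJia_centralOrder_anticyclotomicTwists`);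
[BurungaleKobayashiNakamuraOta2026] (1.2)/Thm. 6.7 (tree `thm67_mordellWeilRank_layer_OPEN`);
[SilvermanATAEC1994] II Thms. 9.2/10.5 (tree `Deuring_exists_heckeCharacter_of_maximalCM`).
-/

noncomputable section

open scoped Classical
open Filter Finset WeierstrassCurve NumberField IsDedekindDomain
open Literature.NumberTheory.Automorphic Literature.NumberTheory.GaloisRepresentations
open Literature.NumberTheory.EllipticCurves.BurungaleKobayashiNakamuraOta2026 (IsAcCharacter
  thm67_mordellWeilRank_layer_OPEN)

namespace Literature.NumberTheory.EllipticCurves.LiXu2026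

/-! ## §1 Theorem 1 for `E/ℚ` (refereed named facts; nothing proved here) -/

/-- **Li–Xu 2026, Theorem 1, SPLIT case, for `A_φ = E`: at a prime `p` split in `K` the rank is
eventually stationary if `W(φ) = 1` and eventually grows by `2φ(p^n)` per layer if `W(φ) = −1`** —
"If `p` splits in `K`, then `ε_n = 0` if `W(φ) = 1`, and `ε_n = 2d` if `W(φ) = −1`" (for `n ≫ 0`, where
`rank_ℤ A_φ(K_n^{ac}) − rank_ℤ A_φ(K_{n−1}^{ac}) = ε_n φ(p^n)`; `d = 1` for an elliptic curve, §1.1 and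
Rem. 4.3). Transcription (module docstring): the maximal-order CM frame, `φ` by Deuring's clauses,
`W(φ) = w ∈ ℤ` via `IsCentralRootNumber φ w`; `p` odd, `p ∤ d_K` and `p𝒪_K` not prime (split); `κ`
anticyclotomic; conclusion `∀ᶠ n, rank_ℤ E(K^{ac}_{n+1}) = rank_ℤ E(K^{ac}_n) + (1 − w)·φ(p^{n+1})`
(`(1 − w) ∈ {0, 2}`). REFEREED (J. Number Theory 2026; this case is classical: Greenberg 1983 /
Rohrlich 1984 + Gross–Zagier–Kolyvagin). No `_holds` (Weil restriction / GZK for the twists `A_{φρ}`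
are not tree theorems). [cite: LiXu2026, Thm. 1 (split case) and §1.1, Rem. 4.3 (arXiv:2502.12648)] -/
def thm1_mordellWeilRank_layer_split : Prop :=
  ∀ (W : WeierstrassCurve ℚ) [W.IsElliptic], W.j ∈ maximalCMJInvariants →
    ∀ (K : Type) [Field K] [NumberField K], IsCMFieldOfJ K W.j → ∀ (c : K ≃ₐ[ℚ] K), c ≠ 1 →
      ∀ (φ : HeckeCharacter K), φ.HasInfinityType (fun _ ↦ 1) (fun _ ↦ 0) →
        IsHeckeConjEquivariant c φ → (∀ s : ℂ, 3 / 2 < s.re → heckeLFunction φ s = W.LSeries s) →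
      ∀ (w : ℤ), IsCentralRootNumber φ w →
      ∀ (p : ℕ) [Fact p.Prime], p ≠ 2 → ¬ (p : ℤ) ∣ cmFieldDiscr W.j →
        ¬ (Ideal.span {(p : 𝓞 K)}).IsPrime →
        ∀ (κ : ZpExtension K p), κ.IsAnticyclotomic →
          ∀ᶠ n : ℕ in atTop,
            ((W.baseChange (κ.layer (n + 1))).mordellWeilRank : ℤ) =
              ((W.baseChange (κ.layer n)).mordellWeilRank : ℤ) + (1 - w) * ((p ^ (n + 1)).totient : ℤ)

/-- **Li–Xu 2026, Theorem 1, INERT case, for `A_φ = E` with GOOD reduction at `p`: at every other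
layer the rank grows by `2φ(p^n)`, at the layers `n` with `(−1)^n = W(φ)`** — "If `p` remains inert in
`K`, let `j` be the nonnegative integer so that `H_K ∩ K_∞^{ac} = K_j^{ac}` […] and let `f(φ_p)` be the
exponent of the conductor of the `p`-component of `φ`. Then if `j + f(φ_p)` is even, then `ε_n = 2d`
if `n ≡ W̃(φ) mod 2`, `0` if `n ≢ W̃(φ) mod 2`" with `W̃(φ) = (1 − W(φ))/2`, and Rem. 4.3: for an elliptic
curve `j = 0`, and "when `E` has good reduction at `p`, the associated Hecke character `φ` of `E` is
unramified at `p`. Therefore `j + f(φ_p) = 0`, an even number." So for `E` good at `p`: `ε_m = 2` iff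
`m ≡ W̃(φ) (mod 2)` iff `(−1)^m = W(φ)`, i.e. `ε_m = 1 + (−1)^m W(φ)`. Transcription: the frame of
`thm1_mordellWeilRank_layer_split`; `p` odd with `p𝒪_K` prime (inert) and `W.HasGoodReductionAtPrime p`;
conclusion `∀ᶠ n, rank_ℤ E(K^{ac}_{n+1}) = rank_ℤ E(K^{ac}_n) + (1 + (−1)^{n+1} w)·φ(p^{n+1})`. (The
Selmer-corank companion is Agboola–Howard's Theorem A, `AgboolaHoward2005.thmA_selmerCorank_layer_inert`;
inert `p` of bad reduction — `f(φ_p) > 0` — is not typed.) REFEREED. No `_holds`.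
[cite: LiXu2026, Thm. 1 (inert case) and Rem. 4.3 (arXiv:2502.12648)] [cite: Greenberg1983, p. 247] -/
def thm1_mordellWeilRank_layer_inert : Prop :=
  ∀ (W : WeierstrassCurve ℚ) [W.IsElliptic], W.j ∈ maximalCMJInvariants →
    ∀ (K : Type) [Field K] [NumberField K], IsCMFieldOfJ K W.j → ∀ (c : K ≃ₐ[ℚ] K), c ≠ 1 →
      ∀ (φ : HeckeCharacter K), φ.HasInfinityType (fun _ ↦ 1) (fun _ ↦ 0) →
        IsHeckeConjEquivariant c φ → (∀ s : ℂ, 3 / 2 < s.re → heckeLFunction φ s = W.LSeries s) →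
      ∀ (w : ℤ), IsCentralRootNumber φ w →
      ∀ (p : ℕ) [Fact p.Prime], p ≠ 2 → (Ideal.span {(p : 𝓞 K)}).IsPrime →
        W.HasGoodReductionAtPrime p →
        ∀ (κ : ZpExtension K p), κ.IsAnticyclotomic →
          ∀ᶠ n : ℕ in atTop,
            ((W.baseChange (κ.layer (n + 1))).mordellWeilRank : ℤ) =
              ((W.baseChange (κ.layer n)).mordellWeilRank : ℤ) +
                (1 + (-1) ^ (n + 1) * w) * ((p ^ (n + 1)).totient : ℤ)

/-- **Li–Xu 2026, Theorem 1, RAMIFIED case, for `A_φ = E`: at a prime `p` ramified in `K` the rank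
eventually grows by exactly `φ(p^n)` per layer** — "If `p` is ramified in `K`, then `ε_n = d`" (for
`n ≫ 0`; `d = 1` for an elliptic curve). Transcription: the frame of `thm1_mordellWeilRank_layer_split`;
`p` odd with `p ∣ d_K` (ramified); conclusion `∀ᶠ n, rank_ℤ E(K^{ac}_{n+1}) = rank_ℤ E(K^{ac}_n) +
φ(p^{n+1})`. This is the REFEREED counterpart of Burungale–Kobayashi–Nakamura–Ota's (1.2)/Thm. 6.7
(`BurungaleKobayashiNakamuraOta2026.thm67_mordellWeilRank_layer_OPEN`, preprint): see
`step_of_thm67_OPEN` (BKNO's form implies this one) and `mordellWeilRank_layer_eq_pow_add_of_ramified`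
(this one gives `rank_ℤ E(K^{ac}_n) = p^n + C`, BKNO's form up to the parity of `C`). REFEREED (proof:
Thm. 3.11 (iv)–(v) — half of the level-`n` twists have root number `+1` — Rohrlich, GZK–Zhang). No
`_holds`. [cite: LiXu2026, Thm. 1 (ramified case) and §4 proof, Case 3 (arXiv:2502.12648)] -/
def thm1_mordellWeilRank_layer_ramified : Prop :=
  ∀ (W : WeierstrassCurve ℚ) [W.IsElliptic], W.j ∈ maximalCMJInvariants →
    ∀ (K : Type) [Field K] [NumberField K], IsCMFieldOfJ K W.j → ∀ (c : K ≃ₐ[ℚ] K), c ≠ 1 →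
      ∀ (φ : HeckeCharacter K), φ.HasInfinityType (fun _ ↦ 1) (fun _ ↦ 0) →
        IsHeckeConjEquivariant c φ → (∀ s : ℂ, 3 / 2 < s.re → heckeLFunction φ s = W.LSeries s) →
      ∀ (p : ℕ) [Fact p.Prime], p ≠ 2 → (p : ℤ) ∣ cmFieldDiscr W.j →
        ∀ (κ : ZpExtension K p), κ.IsAnticyclotomic →
          ∀ᶠ n : ℕ in atTop,
            ((W.baseChange (κ.layer (n + 1))).mordellWeilRank : ℤ) =
              ((W.baseChange (κ.layer n)).mordellWeilRank : ℤ) + ((p ^ (n + 1)).totient : ℤ)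

/-! ## §2 Theorem 3.11 (i) for `E/ℚ` (refereed named fact) -/

/-- **Li–Xu 2026, Theorem 3.11 (i): at a SPLIT prime the anticyclotomic twists do not change the
root number** — "If `p` splits in `K`, then `W(χ) = W(φ)`" for `χ = φρ ∈ 𝔛^{ac}_{φ,n}` (every `ρ`
factoring through `Gal(K^{ac}_n/K)`, any `n`). Transcription: the maximal-order CM frame; `p` odd split
(`p ∤ d_K`, `p𝒪_K` not prime); `ρ` a finite-order character of `Γ^{ac}` of level `≤ n` with `p`-adic
avatar `r` (`IsAcCharacter ι κ n ρ r`); root numbers in the weight-two normalisation; conclusion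
`W(φ) = w ⟹ W(φρ) = w`. REFEREED (Lemma "psplits" + Prop. "reducetop" of §3; for `E`, Greenberg 1983,
Rem. 3.12). No `_holds`. [cite: LiXu2026, Thm. 3.11 (i) and Rem. 3.12 (arXiv:2502.12648)]
[cite: Greenberg1983, p. 247] -/
def thm311_rootNumber_split : Prop :=
  ∀ (W : WeierstrassCurve ℚ) [W.IsElliptic], W.j ∈ maximalCMJInvariants →
    ∀ (K : Type) [Field K] [NumberField K], IsCMFieldOfJ K W.j → ∀ (c : K ≃ₐ[ℚ] K), c ≠ 1 →
      ∀ (φ : HeckeCharacter K), φ.HasInfinityType (fun _ ↦ 1) (fun _ ↦ 0) →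
        IsHeckeConjEquivariant c φ → (∀ s : ℂ, 3 / 2 < s.re → heckeLFunction φ s = W.LSeries s) →
      ∀ (p : ℕ) [Fact p.Prime], p ≠ 2 → ¬ (p : ℤ) ∣ cmFieldDiscr W.j →
        ¬ (Ideal.span {(p : 𝓞 K)}).IsPrime →
        ∀ (κ : ZpExtension K p), κ.IsAnticyclotomic →
        ∀ (ι : PadicAlgCl p ≃+* ℂ) (n : ℕ) (ρ : HeckeCharacter K)
          (r : FramedGaloisRep K (PadicAlgCl p) 1), IsAcCharacter ι κ n ρ r →
          ∀ (w : ℂ), IsCentralRootNumber φ w → IsCentralRootNumber (φ * ρ) w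

/-! ## §3 Proposition 5.2 for `A = E` (refereed named fact) -/

/-- **Li–Xu 2026, Proposition 5.2, for an elliptic curve: the torsion of `E` over the anticyclotomic
tower is finite** — "Let `A/ℚ` be an abelian variety over `ℚ`, then `A(K_∞^{ac})_{tors}` is finite."
(`K` imaginary quadratic, `p` odd, `K_∞^{ac}` its anticyclotomic `ℤ_p`-extension; proof: reduction at
two auxiliary primes `q ≠ p` inert in `K`, which split completely in `K^{ac}_∞`, Lemma 5.1, and
`A(K^{ac}_n)[m] ↪ Ã(𝔽_{q²})`, Serre–Tate.) Transcription: `W/ℚ` ANY elliptic Weierstrass curve (no CM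
hypothesis), `K` with `IsImaginaryQuadratic K`, `p ≠ 2`, `κ : ZpExtension K p` anticyclotomic; since
`E(K^{ac}_∞) = ⋃_n E(K^{ac}_n)`, finiteness of `E(K^{ac}_∞)_{tors}` is typed as BOUNDEDNESS of the torsion
orders over the layers: `∃ B, ∀ n, #E(K^{ac}_n)_{tors} ≤ B` (`WeierstrassCurve.torsionOrder` of the base
change to `κ.layer n`; each is finite over a number field, so this is equivalent to the printed
finiteness). REFEREED. No `_holds` (the splitting of inert primes in `K^{ac}_∞/K` and the injectivity of
reduction on prime-to-`q` torsion over the layers are not assembled in the tree).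
[cite: LiXu2026, Prop. 5.2 and Lemma 5.1 (arXiv:2502.12648)] -/
def prop52_torsionOrder_layer_bounded : Prop :=
  ∀ (W : WeierstrassCurve ℚ) [W.IsElliptic] (K : Type) [Field K] [NumberField K],
    IsImaginaryQuadratic K → ∀ (p : ℕ) [Fact p.Prime], p ≠ 2 →
      ∀ (κ : ZpExtension K p), κ.IsAnticyclotomic →
        ∃ B : ℕ, ∀ n : ℕ, (W.baseChange (κ.layer n)).torsionOrder ≤ B

/-! ## §4 Proved corollaries and the bridges to the BKNO binder (kernel; facts as hypotheses) -/

/-- Plumbing: the sign `w ∈ ℤ` of `L(E/ℚ, s) = L(s, φ)` is `±1` (`IsCentralRootNumber.eq_one_or_eq_neg_one`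
and `WeierstrassCurve.exists_LSeries_ofReal_ne_zero`). [folklore] -/
private theorem sign_eq_one_or_eq_neg_one {K : Type} [Field K] [NumberField K]
    (W : WeierstrassCurve ℚ) (φ : HeckeCharacter K)
    (hL : ∀ s : ℂ, 3 / 2 < s.re → heckeLFunction φ s = W.LSeries s)
    {w : ℤ} (hw : IsCentralRootNumber φ w) : w = 1 ∨ w = -1 := by
  obtain ⟨x, hx, hne⟩ := W.exists_LSeries_ofReal_ne_zero
  have hx' : (3 / 2 : ℝ) < (x : ℂ).re := by simpa using hx
  have hL' : ∃ s : ℂ, 3 / 2 < s.re ∧ heckeLFunction φ s ≠ 0 := ⟨x, hx', by rwa [hL x hx']⟩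
  rcases hw.eq_one_or_eq_neg_one hL' with h | h
  · left; exact_mod_cast h
  · right; exact_mod_cast h

/-- Plumbing (telescoping): if an integer sequence eventually satisfies `a(n+1) = a(n) + φ(p^{n+1})`,
then `a(n) = p^n + C` for `n ≥ n₀` (`Σ_{k=n₀+1}^{n} φ(p^k) = p^n − p^{n₀}`). [folklore] -/
private theorem eq_pow_add_of_step {p : ℕ} (hp : p.Prime) {a : ℕ → ℤ}
    (h : ∀ᶠ n : ℕ in atTop, a (n + 1) = a n + ((p ^ (n + 1)).totient : ℤ)) :
    ∃ (n₀ : ℕ) (C : ℤ), ∀ n, n₀ ≤ n → a n = (p : ℤ) ^ n + C := by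
  obtain ⟨n₀, hn₀⟩ := eventually_atTop.mp h
  refine ⟨n₀, a n₀ - (p : ℤ) ^ n₀, fun n hn ↦ ?_⟩
  induction n, hn using Nat.le_induction with
  | base => ring
  | succ n hmn ih =>
    rw [hn₀ n hmn, ih, Nat.totient_prime_pow_succ hp]
    have h1 : 1 ≤ p := hp.one_lt.le
    push_cast [Nat.cast_sub h1]
    ring

section CMFrame

variable (W : WeierstrassCurve ℚ) [W.IsElliptic] (hj : W.j ∈ maximalCMJInvariants)
  (K : Type) [Field K] [NumberField K] (hK : IsCMFieldOfJ K W.j) (c : K ≃ₐ[ℚ] K) (hc : c ≠ 1)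
  (φ : HeckeCharacter K) (hφ : φ.HasInfinityType (fun _ ↦ 1) (fun _ ↦ 0))
  (heq : IsHeckeConjEquivariant c φ) (hL : ∀ s : ℂ, 3 / 2 < s.re → heckeLFunction φ s = W.LSeries s)
  (p : ℕ) [Fact p.Prime] (hp : p ≠ 2) (κ : ZpExtension K p) (hκ : κ.IsAnticyclotomic)

include hj hK hc hφ heq hL hp hκ

/-- **The closed form of the ramified growth: `rank_ℤ E(K^{ac}_n) = p^n + C` for `n ≥ n₀`** — granted
Theorem 1 (ramified case, hypothesis `h1`) at `p ∣ d_K`: telescoping `Σ_{k=n₀+1}^{n} φ(p^k) =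
p^n − p^{n₀}`. This is BKNO's (1.2) "`rank_{𝒪_K} E(K^{ac}_n) = (p^n − 1)/2 + c`" (doubled: `p^n − 1 + 2c`)
up to the PARITY of the constant (`C = 2c − 1` would say `rank_ℤ` is even — the `𝒪_K`-structure, not
carried by the tree's `ℤ`-rank). PROVED. [cite: LiXu2026, Thm. 1 (ramified case) (arXiv:2502.12648)] -/
theorem mordellWeilRank_layer_eq_pow_add_of_ramified (h1 : thm1_mordellWeilRank_layer_ramified)
    (hram : (p : ℤ) ∣ cmFieldDiscr W.j) :
    ∃ (n₀ : ℕ) (C : ℤ), ∀ n, n₀ ≤ n →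
      ((W.baseChange (κ.layer n)).mordellWeilRank : ℤ) = (p : ℤ) ^ n + C :=
  eq_pow_add_of_step (Fact.out : p.Prime) (h1 W hj K hK c hc φ hφ heq hL p hp hram κ hκ)

/-- **Unbounded rank in the ramified tower** (granted Theorem 1, ramified case):
`rank_ℤ E(K^{ac}_n) → ∞`. PROVED. [cite: LiXu2026, Thm. 1 (ramified case) and Cor. 5.4 (arXiv:2502.12648)] -/
theorem tendsto_mordellWeilRank_layer_of_ramified (h1 : thm1_mordellWeilRank_layer_ramified)
    (hram : (p : ℤ) ∣ cmFieldDiscr W.j) :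
    Tendsto (fun n : ℕ ↦ ((W.baseChange (κ.layer n)).mordellWeilRank : ℤ)) atTop atTop := by
  obtain ⟨n₀, C, hC⟩ := mordellWeilRank_layer_eq_pow_add_of_ramified W hj K hK c hc φ hφ heq hL p hp κ hκ h1 hram
  have hp1 : 1 < (p : ℤ) := by exact_mod_cast (Fact.out : p.Prime).one_lt
  have hpow : Tendsto (fun n : ℕ ↦ (p : ℤ) ^ n + C) atTop atTop :=
    tendsto_atTop_add_const_right _ _ (tendsto_pow_atTop_atTop_of_one_lt hp1)
  refine hpow.congr' ?_
  filter_upwards [eventually_ge_atTop n₀] with n hn using (hC n hn).symm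

/-- **`W(φ) = +1` at a SPLIT prime: the rank is eventually constant** (granted Theorem 1, split case,
hypothesis `h1`) — the rank half of the "if" direction of Cor. 5.4 ("`A_φ(K_∞^{ac})` is a finitely
generated abelian group if and only if `p` splits in `K` and `W(φ) = 1`"). PROVED (`(1 − 1)·φ = 0`).
[cite: LiXu2026, Thm. 1 (split case) and Cor. 5.4 (arXiv:2502.12648)] -/
theorem mordellWeilRank_layer_eventually_const_of_split_pos (h1 : thm1_mordellWeilRank_layer_split)
    (hnd : ¬ (p : ℤ) ∣ cmFieldDiscr W.j) (hns : ¬ (Ideal.span {(p : 𝓞 K)}).IsPrime)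
    (hw : IsCentralRootNumber φ (1 : ℤ)) :
    ∃ (n₀ : ℕ) (C : ℤ), ∀ n, n₀ ≤ n → ((W.baseChange (κ.layer n)).mordellWeilRank : ℤ) = C := by
  have h := h1 W hj K hK c hc φ hφ heq hL 1 hw p hp hnd hns κ hκ
  obtain ⟨n₀, hn₀⟩ := eventually_atTop.mp h
  refine ⟨n₀, ((W.baseChange (κ.layer n₀)).mordellWeilRank : ℤ), fun n hn ↦ ?_⟩
  induction n, hn using Nat.le_induction with
  | base => rfl
  | succ n hmn ih => rw [hn₀ n hmn, ih]; ring

/-- **`W(φ) = −1` at a SPLIT prime: `rank_ℤ E(K^{ac}_n) → ∞`** (granted Theorem 1, split case: the step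
is `2φ(p^{n+1}) ≥ 2`). PROVED. [cite: LiXu2026, Thm. 1 (split case) and §1.3 (arXiv:2502.12648)] -/
theorem tendsto_mordellWeilRank_layer_of_split_neg (h1 : thm1_mordellWeilRank_layer_split)
    (hnd : ¬ (p : ℤ) ∣ cmFieldDiscr W.j) (hns : ¬ (Ideal.span {(p : 𝓞 K)}).IsPrime)
    (hw : IsCentralRootNumber φ ((-1 : ℤ) : ℂ)) :
    Tendsto (fun n : ℕ ↦ ((W.baseChange (κ.layer n)).mordellWeilRank : ℤ)) atTop atTop := by
  have h := h1 W hj K hK c hc φ hφ heq hL (-1) hw p hp hnd hns κ hκ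
  obtain ⟨n₀, hn₀⟩ := eventually_atTop.mp h
  have hpos : 0 < p := (Fact.out : p.Prime).pos
  -- from `n₀` on, the rank gains at least `2` per step
  have hlow : ∀ n, n₀ ≤ n → ((W.baseChange (κ.layer n₀)).mordellWeilRank : ℤ) + 2 * (n - n₀ : ℕ) ≤
      ((W.baseChange (κ.layer n)).mordellWeilRank : ℤ) := by
    intro n hn
    induction n, hn using Nat.le_induction with
    | base => simp
    | succ n hmn ih =>
      rw [hn₀ n hmn]
      have ht : (1 : ℤ) ≤ ((p ^ (n + 1)).totient : ℤ) := by
        exact_mod_cast Nat.totient_pos.mpr (pow_pos hpos (n + 1))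
      have hsub : ((n + 1 - n₀ : ℕ) : ℤ) = ((n - n₀ : ℕ) : ℤ) + 1 := by
        rw [Nat.sub_add_comm hmn]; push_cast; ring
      rw [hsub]
      linarith
  refine tendsto_atTop_atTop.mpr fun b ↦ ?_
  obtain ⟨m, hm⟩ : ∃ m : ℕ, b ≤ ((W.baseChange (κ.layer n₀)).mordellWeilRank : ℤ) + 2 * (m : ℤ) :=
    ⟨(b - ((W.baseChange (κ.layer n₀)).mordellWeilRank : ℤ)).toNat, by omega⟩
  refine ⟨n₀ + m, fun n hn ↦ le_trans hm (le_trans ?_ (hlow n (by omega)))⟩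
  have : (m : ℤ) ≤ ((n - n₀ : ℕ) : ℤ) := by exact_mod_cast (show m ≤ n - n₀ by omega)
  linarith

/-- **INERT prime of good reduction: `rank_ℤ E(K^{ac}_n) → ∞`** (granted Theorem 1, inert case: every
two steps the rank gains `2φ(p^k) ≥ 2`, since one of `(−1)^{n+1}, (−1)^{n+2}` equals `W(φ) = ±1`) — "The
anticyclotomic `ℤ_p`-extension `K_∞^{ac}/K` again provides a counterexample to this expectation, as
first observed in [Greenberg 1983]" (§1.3). PROVED. [cite: LiXu2026, Thm. 1 (inert case) and §1.3 (arXiv:2502.12648)] -/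
theorem tendsto_mordellWeilRank_layer_of_inert (h1 : thm1_mordellWeilRank_layer_inert)
    (hinert : (Ideal.span {(p : 𝓞 K)}).IsPrime) (hgood : W.HasGoodReductionAtPrime p)
    (w : ℤ) (hw : IsCentralRootNumber φ w) :
    Tendsto (fun n : ℕ ↦ ((W.baseChange (κ.layer n)).mordellWeilRank : ℤ)) atTop atTop := by
  have hw1 : w = 1 ∨ w = -1 := sign_eq_one_or_eq_neg_one W φ hL hw
  have h := h1 W hj K hK c hc φ hφ heq hL w hw p hp hinert hgood κ hκ
  obtain ⟨n₀, hn₀⟩ := eventually_atTop.mp h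
  have hpos : 0 < p := (Fact.out : p.Prime).pos
  set a : ℕ → ℤ := fun n ↦ ((W.baseChange (κ.layer n)).mordellWeilRank : ℤ) with ha
  -- each step is nonnegative, and two consecutive steps gain at least `2`
  have hstep_nonneg : ∀ n, n₀ ≤ n → a n ≤ a (n + 1) := by
    intro n hn
    have ht : (0 : ℤ) ≤ ((p ^ (n + 1)).totient : ℤ) := by positivity
    have hc : (0 : ℤ) ≤ 1 + (-1) ^ (n + 1) * w := by
      rcases hw1 with rfl | rfl <;> rcases neg_one_pow_eq_or ℤ (n + 1) with h' | h' <;>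
        rw [h'] <;> norm_num
    have := hn₀ n hn
    simp only [ha] at this ⊢
    nlinarith
  have htwo : ∀ n, n₀ ≤ n → a n + 2 ≤ a (n + 2) := by
    intro n hn
    have e1 := hn₀ n hn
    have e2 := hn₀ (n + 1) (by omega)
    have ht1 : (1 : ℤ) ≤ ((p ^ (n + 1)).totient : ℤ) := by
      exact_mod_cast Nat.totient_pos.mpr (pow_pos hpos (n + 1))
    have ht2 : (1 : ℤ) ≤ ((p ^ (n + 1 + 1)).totient : ℤ) := by
      exact_mod_cast Nat.totient_pos.mpr (pow_pos hpos (n + 1 + 1))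
    -- one of the two coefficients is `2`, the other `0`
    have hcoef : (1 + (-1 : ℤ) ^ (n + 1) * w = 2 ∧ 1 + (-1 : ℤ) ^ (n + 1 + 1) * w = 0) ∨
        (1 + (-1 : ℤ) ^ (n + 1) * w = 0 ∧ 1 + (-1 : ℤ) ^ (n + 1 + 1) * w = 2) := by
      rw [pow_succ (-1 : ℤ) (n + 1)]
      rcases hw1 with rfl | rfl <;> rcases neg_one_pow_eq_or ℤ (n + 1) with h' | h' <;>
        rw [h'] <;> norm_num
    simp only [ha] at e1 e2 ⊢
    rcases hcoef with ⟨c1, c2⟩ | ⟨c1, c2⟩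
    · rw [c1] at e1; rw [c2] at e2; nlinarith
    · rw [c1] at e1; rw [c2] at e2; nlinarith
  have hlow : ∀ m : ℕ, a n₀ + 2 * (m : ℤ) ≤ a (n₀ + 2 * m) := by
    intro m
    induction m with
    | zero => simp
    | succ m ih =>
      have h2 := htwo (n₀ + 2 * m) (by omega)
      have : n₀ + 2 * (m + 1) = n₀ + 2 * m + 2 := by ring
      rw [this]; push_cast; linarith
  have hmono : ∀ n m, n₀ ≤ n → n ≤ m → a n ≤ a m := by
    intro n m hn hnm
    induction m, hnm using Nat.le_induction with
    | base => exact le_rfl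
    | succ m hmn ih => exact le_trans ih (hstep_nonneg m (by omega))
  refine tendsto_atTop_atTop.mpr fun b ↦ ?_
  obtain ⟨m, hm⟩ : ∃ m : ℕ, b ≤ a n₀ + 2 * (m : ℤ) := ⟨(b - a n₀).toNat, by omega⟩
  exact ⟨n₀ + 2 * m, fun n hn ↦ le_trans hm (le_trans (hlow m) (hmono _ _ (by omega) hn))⟩

omit hc hφ heq hL in
/-- **BKNO's preprint binder implies Li–Xu's refereed ramified step form**: granted
`thm67_mordellWeilRank_layer_OPEN` (BKNO (1.2)/Thm. 6.7 for `E`: `rank_ℤ E(K^{ac}_n) = p^n − 1 + 2c` for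
`n ≫ 0`), the rank eventually grows by exactly `φ(p^{n+1}) = p^{n+1} − p^n` per layer. PROVED — the two
by-name nodes agree on the growth; BKNO's additionally fixes the parity of the constant.
[claim: BurungaleKobayashiNakamuraOta2026, status: under-review] [cite: LiXu2026, Thm. 1 (ramified case) (arXiv:2502.12648)] -/
theorem step_of_thm67_OPEN (h67 : thm67_mordellWeilRank_layer_OPEN) (hram : (p : ℤ) ∣ cmFieldDiscr W.j) :
    ∀ᶠ n : ℕ in atTop,
      ((W.baseChange (κ.layer (n + 1))).mordellWeilRank : ℤ) =
        ((W.baseChange (κ.layer n)).mordellWeilRank : ℤ) + ((p ^ (n + 1)).totient : ℤ) := by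
  obtain ⟨c₀, hc₀⟩ := h67 W hj K hK p hp hram κ hκ
  have hc₁ : ∀ᶠ n : ℕ in atTop,
      ((W.baseChange (κ.layer (n + 1))).mordellWeilRank : ℤ) = (p : ℤ) ^ (n + 1) - 1 + 2 * c₀ :=
    (tendsto_add_atTop_nat 1).eventually hc₀
  have hp' : p.Prime := Fact.out
  have h1 : 1 ≤ p := hp'.one_lt.le
  filter_upwards [hc₀, hc₁] with n hn hn1
  rw [hn, hn1, Nat.totient_prime_pow_succ hp']
  push_cast [Nat.cast_sub h1]
  ring

end CMFrame

/-! ## §5 The inert clauses with the conductor exponent `f(φ_p)` explicit (covers BAD reduction at an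
inert `p`; refereed named facts) -/

/-- **Li–Xu 2026, Theorem 1, INERT case, for `A_φ = E`, both parity branches** — "If `p` remains inert
in `K`, let `j` be the nonnegative integer so that `H_K ∩ K_∞^{ac} = K_j^{ac}` […] and let `f(φ_p)` be the
exponent of the conductor of the `p`-component of `φ`. Then • if `j + f(φ_p)` is even, then `ε_n = 2d`
if `n ≡ W̃(φ) mod 2`, `0` if `n ≢ W̃(φ) mod 2`, • if `j + f(φ_p)` is odd, then `ε_n = 0` if
`n ≡ W̃(φ) mod 2`, `2d` if `n ≢ W̃(φ) mod 2`" (`n ≫ 0`; `W̃(φ) = (1 − W(φ))/2`; for `E/ℚ`: `d = 1`, `j = 0`,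
Rem. 4.3). With `f = f(φ_p)` both branches read: `ε_n = 2` iff `(−1)^{n+f} W(φ) = 1`, i.e.
`ε_n = 1 + (−1)^{n+f} W(φ)`. Transcription: the frame of `thm1_mordellWeilRank_layer_split`; `p` odd,
`p𝒪_K` a prime ideal (inert) equal to `v.asIdeal` for the finite place `v` of `K`; `φ` has conductor
exponent `f` at `v` (`HeckeCharacter.HasConductorExponentAt φ v f`, the printed `f(φ_p) = f`, Li–Xu
§2.1.1's convention `f = 0 ⟺` unramified); NO reduction hypothesis (an inert `p` of bad — additive —
reduction has `f > 0`); conclusion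
`∀ᶠ n, rank_ℤ E(K^{ac}_{n+1}) = rank_ℤ E(K^{ac}_n) + (1 + (−1)^{n+1+f} w)·φ(p^{n+1})`. (The sub-case
`f = 0` is `thm1_mordellWeilRank_layer_inert`, stated there under GOOD reduction, which gives `f(φ_p) = 0`
by Rem. 4.3 — that implication, Deuring/Serre–Tate, is not a tree theorem, so both forms are kept.)
REFEREED. No `_holds`. [cite: LiXu2026, Thm. 1 (inert case, both branches), §2.1.1 and Rem. 4.3 (arXiv:2502.12648)] -/
def thm1_mordellWeilRank_layer_inert_of_conductorExponent : Prop :=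
  ∀ (W : WeierstrassCurve ℚ) [W.IsElliptic], W.j ∈ maximalCMJInvariants →
    ∀ (K : Type) [Field K] [NumberField K], IsCMFieldOfJ K W.j → ∀ (c : K ≃ₐ[ℚ] K), c ≠ 1 →
      ∀ (φ : HeckeCharacter K), φ.HasInfinityType (fun _ ↦ 1) (fun _ ↦ 0) →
        IsHeckeConjEquivariant c φ → (∀ s : ℂ, 3 / 2 < s.re → heckeLFunction φ s = W.LSeries s) →
      ∀ (w : ℤ), IsCentralRootNumber φ w →
      ∀ (p : ℕ) [Fact p.Prime], p ≠ 2 → (Ideal.span {(p : 𝓞 K)}).IsPrime →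
        ∀ (v : HeightOneSpectrum (𝓞 K)), v.asIdeal = Ideal.span {(p : 𝓞 K)} →
        ∀ (f : ℕ), φ.HasConductorExponentAt v f →
        ∀ (κ : ZpExtension K p), κ.IsAnticyclotomic →
          ∀ᶠ n : ℕ in atTop,
            ((W.baseChange (κ.layer (n + 1))).mordellWeilRank : ℤ) =
              ((W.baseChange (κ.layer n)).mordellWeilRank : ℤ) +
                (1 + (-1) ^ (n + 1 + f) * w) * ((p ^ (n + 1)).totient : ℤ)

/-- **Li–Xu 2026, Theorem 3.11 (ii), for `A_φ = E` (`j = 0`), with the conductor exponent explicit: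
at an INERT `p` the root number of a twist of exact level `n ≥ 1` is `W(φ)` while `n ≤ f(φ_p) − 1` and
`(−1)^{n+1−f(φ_p)} W(φ)` from `n ≥ f(φ_p)` on** — "If `p` remains inert in `K`, then `W(χ) = W(φ)` if
`n ≤ j + f(φ_p) − 1`, `W(χ) = (−1)^{n−j+1−f(φ_p)} W(φ)` if `n > j + f(φ_p) − 1`" for `χ = φρ`, `ρ` of
(exact, Prop. 2.4 (2)) level `n` — read with `n ≥ 1` (module docstring, "PRINT NIT"). Transcription:
the maximal-order CM frame; `p` odd, `p𝒪_K = v.asIdeal` prime; `φ.HasConductorExponentAt v f`;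
`ρ` of level `≤ n` (`IsAcCharacter ι κ n ρ r`) and not of level `≤ n − 1`, `0 < n`; conclusion, for
`W(φ) = w`: if `n + 1 ≤ f` then `W(φρ) = w`; if `f ≤ n` then `W(φρ) = (−1)^{n+1−f} w`. The sub-case
`f = 0`, `p > 3` (good reduction) is Agboola–Howard's (3.1) = Greenberg 1983 p. 247,
`AgboolaHoward2005.eqn31_rootNumber_layer_inert`. REFEREED. No `_holds`.
[cite: LiXu2026, Thm. 3.11 (ii), Prop. 2.4 (2), Lemma 3.8 (arXiv:2502.12648)] [cite: Greenberg1983, p. 247] -/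
def thm311_rootNumber_layer_inert_of_conductorExponent : Prop :=
  ∀ (W : WeierstrassCurve ℚ) [W.IsElliptic], W.j ∈ maximalCMJInvariants →
    ∀ (K : Type) [Field K] [NumberField K], IsCMFieldOfJ K W.j → ∀ (c : K ≃ₐ[ℚ] K), c ≠ 1 →
      ∀ (φ : HeckeCharacter K), φ.HasInfinityType (fun _ ↦ 1) (fun _ ↦ 0) →
        IsHeckeConjEquivariant c φ → (∀ s : ℂ, 3 / 2 < s.re → heckeLFunction φ s = W.LSeries s) →
      ∀ (p : ℕ) [Fact p.Prime], p ≠ 2 → (Ideal.span {(p : 𝓞 K)}).IsPrime →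
        ∀ (v : HeightOneSpectrum (𝓞 K)), v.asIdeal = Ideal.span {(p : 𝓞 K)} →
        ∀ (f : ℕ), φ.HasConductorExponentAt v f →
        ∀ (κ : ZpExtension K p), κ.IsAnticyclotomic →
        ∀ (ι : PadicAlgCl p ≃+* ℂ) (n : ℕ) (ρ : HeckeCharacter K)
          (r : FramedGaloisRep K (PadicAlgCl p) 1), IsAcCharacter ι κ n ρ r → 0 < n →
          (∃ σ ∈ κ.layerSubgroup (n - 1), avatarValueAt r σ ≠ 1) →
          ∀ (w : ℂ), IsCentralRootNumber φ w →
            (n + 1 ≤ f → IsCentralRootNumber (φ * ρ) w) ∧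
              (f ≤ n → IsCentralRootNumber (φ * ρ) ((-1) ^ (n + 1 - f) * w))

/-- **The general inert step at the layers where it jumps** (granted the fact, hypothesis `h1`): if
`(−1)^{n+1+f} w = 1` the rank gains `2φ(p^{n+1})`, otherwise it is unchanged — for `n ≫ 0`. PROVED
(`w = ±1`, so the coefficient `1 + (−1)^{n+1+f} w ∈ {0, 2}`). [cite: LiXu2026, Thm. 1 (inert case) (arXiv:2502.12648)] -/
theorem mordellWeilRank_layer_inert_step_cases (h1 : thm1_mordellWeilRank_layer_inert_of_conductorExponent)
    (W : WeierstrassCurve ℚ) [W.IsElliptic] (hj : W.j ∈ maximalCMJInvariants)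
    (K : Type) [Field K] [NumberField K] (hK : IsCMFieldOfJ K W.j) (c : K ≃ₐ[ℚ] K) (hc : c ≠ 1)
    (φ : HeckeCharacter K) (hφ : φ.HasInfinityType (fun _ ↦ 1) (fun _ ↦ 0))
    (heq : IsHeckeConjEquivariant c φ) (hL : ∀ s : ℂ, 3 / 2 < s.re → heckeLFunction φ s = W.LSeries s)
    (w : ℤ) (hw : IsCentralRootNumber φ w)
    (p : ℕ) [Fact p.Prime] (hp : p ≠ 2) (hinert : (Ideal.span {(p : 𝓞 K)}).IsPrime)
    (v : HeightOneSpectrum (𝓞 K)) (hv : v.asIdeal = Ideal.span {(p : 𝓞 K)})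
    (f : ℕ) (hf : φ.HasConductorExponentAt v f) (κ : ZpExtension K p) (hκ : κ.IsAnticyclotomic) :
    ∀ᶠ n : ℕ in atTop,
      (((-1 : ℤ) ^ (n + 1 + f) * w = 1 →
        ((W.baseChange (κ.layer (n + 1))).mordellWeilRank : ℤ) =
          ((W.baseChange (κ.layer n)).mordellWeilRank : ℤ) + 2 * ((p ^ (n + 1)).totient : ℤ)) ∧
       ((-1 : ℤ) ^ (n + 1 + f) * w = -1 →
        ((W.baseChange (κ.layer (n + 1))).mordellWeilRank : ℤ) =
          ((W.baseChange (κ.layer n)).mordellWeilRank : ℤ))) := by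
  have h := h1 W hj K hK c hc φ hφ heq hL w hw p hp hinert v hv f hf κ hκ
  filter_upwards [h] with n hn
  refine ⟨fun hs ↦ ?_, fun hs ↦ ?_⟩
  · rw [hn, hs]; ring
  · rw [hn, hs]; ring

end Literature.NumberTheory.EllipticCurves.LiXu2026
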